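import Summits.QuantumAdvantage.QuantumAdvantage.Theses.SpinorFlattening
import Summits.QuantumAdvantage.QuantumAdvantage.Theorems.SpinorFlatteningNegApproxGaussRankSuperpolyMassBound
import Summits.QuantumAdvantage.QuantumAdvantage.Theorems.SpinorFlatteningNegApproxGaussRankSuperpolyNormalOrder
import Summits.QuantumAdvantage.QuantumAdvantage.Theorems.SpinorFlatteningNegApproxGaussRankSuperpolyFilterCard
import Summits.QuantumAdvantage.QuantumAdvantage.Theorems.SpinorFlatteningNegApproxGaussRankSuperpolyFlatOrthoOfInvariant
import Summits.QuantumAdvantage.QuantumAdvantage.Theorems.SpinorFlatteningNegApproxGaussRankSuperpolyMagicInvariant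
import Summits.QuantumAdvantage.QuantumAdvantage.Theorems.SpinorFlatteningNegApproxGaussRankSuperpolyCountGap
import Literature.Computability.QuantumComplexity.GaussianRank

/-!
# Crux `SpinorFlattening.FlatteningBoundRobust` (stmt-QuantumAdvantage-1246) — line `isometric-subflattening-bessel`

CHECKED SKELETON (crux-plan, planner-cruxplan-stmt-QuantumAdvantage-1246-isometric-subflatten-0, 2026-08-16).
Idea card `Cruxes/FlatteningBoundRobust/Ideas/isometric-subflattening-bessel.md` (triage r1-1/r1-2/r1-3: pass,
representative of the merged corollary line ≈ `isometric-subflattening-deficit` ≈ `mass-bound-corollary`).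

## The crux (inline lets ≡ the named API of `GaussianRank.lean`, definitionally)
`∀ t K r, r·D_K(4t) < C(t,K)·8^K → ∀ a g, (∀ i, IsGaussian (g i)) → 1 ≤ C(8t,K) · normSq (M^{⊗t} − Σ aᵢ • gᵢ)`,
`D_K(N) = flatteningDeficiency K N = Σ_{j ≤ K, j ≡ K (2)} C(N,j)`.

## The line — Bessel on the ISOMETRIC one-per-block sub-flattening
Restrict the Clifford-multiplication flattening to the degree-`K` FLAT FAMILY `ι` = (a `K`-subset `B` of the
`t` blocks, one of the 8 Jordan–Wigner Majoranas in each block of `B`), `|ι| = C(t,K)·8^K`, monomials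
`c_S` = ordered products (increasing block order).  Each `c_S` is unitary; the images `c_S M^{⊗t}` are
ORTHONORMAL (fullness); every `c_S φ`, `φ = Σ aᵢ gᵢ`, lies in ONE subspace `W` with `dim W ≤ r·D_K(4t)`
(deficiency, by linearity); Bessel's inequality then gives the MASS BOUND `|ι| − dim W ≤ |ι|·‖M^{⊗t} − φ‖²`,
i.e. the sharp form C⁺ `C(t,K)8^K − r·D_K(4t) ≤ C(t,K)8^K · normSq(M^{⊗t} − φ)` (`bessel_of_stubs`), whence the
crux by the STRICT count (`r·D + 1 ≤ C(t,K)8^K` in ℕ) and `C(t,K)8^K ≤ C(8t,K)` (`FlatteningBoundRobust_of`).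

## Stubs (k = 3) — EVERY ONE IS VERBATIM THE STATEMENT OF A THEOREM ALREADY LANDED IN THE TREE
* `stub_deficiency`     = `Theorems.SpinorFlattening.deficiency`      (p76218; parts `stub_normalOrder` p75761 + `stub_filterCard` p74182)
* `stub_flatOrthonormal` = `Theorems.SpinorFlattening.flatOrthonormal` (p76218; parts `stub_flatOrthoOfInvariant` p74600 + `stub_magicInvariant` p74598)
* `stub_massBound`      = `Theorems.SpinorFlattening.stub_massBound`  (p71968; = the idea card's proved `subflattening_bound_qreg`)
`deficiency_closed` / `flatOrthonormal_closed` / `massBound_closed` / `flatteningBoundRobust_closed` below DISCHARGE all three from the landed theorems (imported through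
the six built part-modules; p76218's composed module `Theorems.SpinorFlatteningNegApproxGaussRankSuperpoly` exports the
first two under the names above but was not yet BUILT on the farm at check time) — so the signatures are exactly the
tree's and the line is closed: the lead replaces each `sorry` by `exact deficiency_closed` / `flatOrthonormal_closed` / `massBound_closed` (or the p76218 name), deletes
nothing else, and lands the file as `Theorems/SpinorFlatteningFlatteningBoundRobust.lean --workitem
stmt-QuantumAdvantage-1246` (no stub workers needed).  `flatteningBoundExact_of_robust` closes item 1249 from it.

## Disproof used (`Cruxes/FlatteningBoundRobust/Disproof.lean` v4 + landed `Theorems/FlatteningBoundRobust/Negative/*`)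
`flatteningBoundRobust_false_without_count` / `_false_with_le`: the STRICT count is used exactly once, in
`FlatteningBoundRobust_of_parts` (`hcount : r·D + 1 ≤ C(t,K)8^K`); `_false_without_gauss` / `_false_without_linIndep`:
`IsGaussian` (with its `LinearIndependent` clause) is consumed by `stub_deficiency` only (n independent annihilators ⇒
n-dimensional complement ⇒ D_K(n) words); §B (`ψ ≠ 0` not load-bearing): unused indeed; §C/§H tightness
(`massBound_attained_t1`, `not_better_than_massBound_t1`, `flatteningBoundRobust_tight_K0`, `not_without_binomial_factor_t1`):
C⁺ keeps the factor C(t,K)8^K and is attained at (1,1,1) — consistent; `_false_with_deficiency_pred`,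
`_false_with_four_fewer_annihilators`: the stubs use the full deficiency D_K and all n annihilators. §E Targets: none.
No stub is an instance of a landed Negative lemma (all three stubs are landed theorems).
-/

set_option linter.dupNamespace false -- D-0017: single-conjunct summit ⇒ `QuantumAdvantage.QuantumAdvantage` by design

noncomputable section

namespace Summit.QuantumAdvantage.QuantumAdvantage.Cruxes.FlatteningBoundRobust.IsometricSubflatteningBessel

open Matrix Finset
open Literature.Computability.QuantumComplexity Literature.Computability.Cryptography

/-! ## Registered stubs -/

/-- **stub_deficiency** — NORMAL-ORDERING DEFICIENCY of the Clifford-multiplication flattening on `r`-term Gaussian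
combinations: for Gaussian `g₁ … g_r` on `n` qubits and any coefficients there is ONE subspace `W` with
`dim W ≤ r · D_K(n)` containing `c_{p₁} ⋯ c_{p_K} (Σ aᵢ gᵢ)` for EVERY list of `K` Majorana labels
(`W` = span of the sorted complement words of length `≤ K`, parity `K`, of all `gᵢ`; CAR normal ordering lowers
each annihilator to the right where it dies on `gᵢ` or contracts).  Size M.  LANDED verbatim as
`Summit.QuantumAdvantage.QuantumAdvantage.Theorems.SpinorFlattening.deficiency` (p76218) — close with `exact` that. -/
theorem stub_deficiency :
    ∀ (n K r : ℕ) (a : Fin r → ℂ) (g : Fin r → QReg n → ℂ), (∀ i, IsGaussian (g i)) →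
      ∃ W : Submodule ℂ (QReg n → ℂ), Module.finrank ℂ W ≤ r * flatteningDeficiency K n ∧
        ∀ l : List (Fin n × Bool), l.length = K →
          (l.map fun p => majorana n p.1 p.2).prod *ᵥ (∑ i, a i • g i) ∈ W := by
  sorry

/-- **stub_flatOrthonormal** — FULLNESS: the one-Majorana-per-block monomial images of `|M⟩^{⊗t}` (ordered products in
increasing block order, at most one of the 8 Jordan–Wigner Majoranas per 4-qubit block) are ORTHONORMAL: unit norm by
unitarity, and for two distinct block patterns a block `X⊗X⊗X⊗X` string or an in-block `Z Z` pair — both fixing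
`|M⟩^{⊗t}` — commutes with one monomial and anticommutes with the other, so the Gram entry equals its own negative.
Size M.  LANDED verbatim as `Summit.QuantumAdvantage.QuantumAdvantage.Theorems.SpinorFlattening.flatOrthonormal`
(p76218) — close with `exact` that. -/
theorem stub_flatOrthonormal :
    ∀ (t : ℕ) (mono : (Fin t → Option (Fin 4 × Bool)) → Matrix (QReg (t * 4)) (QReg (t * 4)) ℂ),
      (∀ s, mono s = ((List.finRange t).filterMap fun b =>
          (s b).map fun q => majorana (t * 4) (finProdFinEquiv (b, q.1)) q.2).prod) →
      (∀ s, star (mono s *ᵥ magicMPow t) ⬝ᵥ (mono s *ᵥ magicMPow t) = 1) ∧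
        ∀ s s', s ≠ s' → star (mono s *ᵥ magicMPow t) ⬝ᵥ (mono s' *ᵥ magicMPow t) = 0 := by
  sorry

/-- **stub_massBound** — BESSEL TAIL FOR A UNITARY FAMILY (the lever of this line): if the `U_i` are unitary, the
vectors `U_i ψ` are orthonormal and every `U_i φ` lies in a subspace `W`, then `|ι| − dim W ≤ |ι| · ‖ψ − φ‖²`
(`‖U_i ψ − U_i φ‖ = ‖ψ − φ‖`; `‖u − w‖² ≥ 1 − ‖P_W u‖²` for `w ∈ W`; `Σᵢ ‖P_W uᵢ‖² ≤ dim W` by Bessel).  Size M.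
LANDED verbatim as `Summit.QuantumAdvantage.QuantumAdvantage.Theorems.SpinorFlattening.stub_massBound` (p71968; the
idea card's own sorry-free `BesselSubflattening.subflattening_bound_qreg` is the same up to the phrasing of the Gram
hypothesis) — close with `exact` that. -/
theorem stub_massBound :
    ∀ (n : ℕ) (ι : Type) [Fintype ι] (U : ι → Matrix (QReg n) (QReg n) ℂ) (ψ φ : QReg n → ℂ)
      (W : Submodule ℂ (QReg n → ℂ)),
      (∀ i, U i ∈ Matrix.unitaryGroup (QReg n) ℂ) →
      (∀ i, star (U i *ᵥ ψ) ⬝ᵥ (U i *ᵥ ψ) = 1) →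
      (∀ i j, i ≠ j → star (U i *ᵥ ψ) ⬝ᵥ (U j *ᵥ ψ) = 0) →
      (∀ i, U i *ᵥ φ ∈ W) →
        (Fintype.card ι : ℝ) - Module.finrank ℂ W ≤ Fintype.card ι * normSq (ψ - φ) := by
  sorry

/-! ## Proved glue: counting -/

/-- Pascal iterated: `C(n, K+1) + m·C(n, K) ≤ C(n+m, K+1)`. -/
theorem choose_succ_add_mul_le (n K m : ℕ) :
    n.choose (K + 1) + m * n.choose K ≤ (n + m).choose (K + 1) := by
  induction m with
  | zero => simp
  | succ m ih =>
    have hmono : n.choose K ≤ (n + m).choose K := Nat.choose_le_choose K (Nat.le_add_right n m)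
    have hP : (n + (m + 1)).choose (K + 1) = (n + m).choose K + (n + m).choose (K + 1) := by
      rw [← Nat.add_assoc, Nat.choose_succ_succ']
    rw [hP]
    nlinarith [ih, hmono]

/-- The injection 𝒮 ↪ K-subsets of the 8t Majoranas, as a count: `C(t,K)·8^K ≤ C(8t,K)`. -/
theorem choose_mul_eight_pow_le (t : ℕ) : ∀ K : ℕ, t.choose K * 8 ^ K ≤ (t * 8).choose K := by
  induction t with
  | zero => intro K; cases K <;> simp
  | succ t ih =>
    intro K
    cases K with
    | zero => simp
    | succ K =>
      have ih0 := ih K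
      have ih1 := ih (K + 1)
      have hA := choose_succ_add_mul_le (t * 8) K 8
      have hmul : (t + 1) * 8 = t * 8 + 8 := by ring
      have ih1' : t.choose (K + 1) * (8 ^ K * 8) ≤ (t * 8).choose (K + 1) := by
        rw [← pow_succ]; exact ih1
      rw [hmul, Nat.choose_succ_succ', pow_succ]
      have hsplit : (t.choose K + t.choose (K + 1)) * (8 ^ K * 8) =
          8 * (t.choose K * 8 ^ K) + t.choose (K + 1) * (8 ^ K * 8) := by ring
      rw [hsplit]
      calc 8 * (t.choose K * 8 ^ K) + t.choose (K + 1) * (8 ^ K * 8)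
          ≤ 8 * (t * 8).choose K + (t * 8).choose (K + 1) :=
            Nat.add_le_add (Nat.mul_le_mul_left 8 ih0) ih1'
        _ ≤ (t * 8 + 8).choose (K + 1) := by linarith [hA]

/-! ## Proved glue: the flat family `ι` = (K-subset of blocks) × (labels) -/

/-- The block pattern of a (`K`-subset of blocks, labelling) pair: `some (label b)` on the subset, `none` off it. -/
def robustPattern {t K : ℕ} (x : Σ B : {B : Finset (Fin t) // B.card = K}, (B.1 → Fin 4 × Bool)) :
    Fin t → Option (Fin 4 × Bool) :=
  fun b => if h : b ∈ x.1.1 then some (x.2 ⟨b, h⟩) else none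

/-- The pattern determines the pair. -/
theorem robustPattern_injective (t K : ℕ) :
    Function.Injective (robustPattern (t := t) (K := K)) := by
  rintro ⟨⟨B, hB⟩, f⟩ ⟨⟨B', hB'⟩, f'⟩ h
  have h' : (fun b => if h : b ∈ B then some (f ⟨b, h⟩) else none) =
      fun b => if h : b ∈ B' then some (f' ⟨b, h⟩) else none := h
  have hBB : B = B' := by
    ext b
    have hb : (if h : b ∈ B then some (f ⟨b, h⟩) else none) =
        if h : b ∈ B' then some (f' ⟨b, h⟩) else none := congrFun h' b
    constructor
    · intro h1
      by_contra h2
      rw [dif_pos h1, dif_neg h2] at hb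
      exact Option.some_ne_none _ hb
    · intro h2
      by_contra h1
      rw [dif_neg h1, dif_pos h2] at hb
      exact Option.some_ne_none _ hb.symm
  subst hBB
  have hff : f = f' := by
    funext x
    obtain ⟨b, hb⟩ := x
    have hx : (if h : b ∈ B then some (f ⟨b, h⟩) else none) =
        if h : b ∈ B then some (f' ⟨b, h⟩) else none := congrFun h' b
    rw [dif_pos hb, dif_pos hb, Option.some.injEq] at hx
    exact hx
  subst hff
  rfl

/-- The pattern of a pair excites exactly `K` blocks. -/
theorem robustPattern_support {t K : ℕ}
    (x : Σ B : {B : Finset (Fin t) // B.card = K}, (B.1 → Fin 4 × Bool)) :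
    (univ.filter fun b => (robustPattern x b).isSome).card = K := by
  unfold robustPattern
  rw [Summit.QuantumAdvantage.QuantumAdvantage.Theorems.SpinorFlattening.countGap_pattern_support]
  exact x.1.2


/-- The labels excited by a block pattern have as many entries as there are excited blocks
(verbatim the landed `Theorems.SpinorFlattening.length_filterMap_labels`, p76218). -/
theorem length_filterMap_labels (t : ℕ) (s : Fin t → Option (Fin 4 × Bool)) :
    ((List.finRange t).filterMap fun b =>
        (s b).map fun q => ((finProdFinEquiv (b, q.1) : Fin (t * 4)), q.2)).length =
      (univ.filter fun b => (s b).isSome).card := by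
  classical
  have key : ∀ L : List (Fin t), (L.filterMap fun b =>
      (s b).map fun q => ((finProdFinEquiv (b, q.1) : Fin (t * 4)), q.2)).length =
        (L.filter fun b => (s b).isSome).length := by
    intro L
    induction L with
    | nil => simp
    | cons b L ih =>
      cases hb : s b with
      | none => simp [hb, ih]
      | some q => simp [hb, ih]
  rw [key, ← List.toFinset_card_of_nodup ((List.nodup_finRange t).filter _)]
  congr 1
  ext b
  simp

/-! ## Composition -/

/-- **C⁺ (the TRANSFER form `FlatteningBoundBessel`, hypothesis-free and sharp)** from the three stub STATEMENTS:
`C(t,K)8^K − r·D_K(4t) ≤ C(t,K)8^K · normSq(M^{⊗t} − Σ aᵢ gᵢ)` — the mass bound applied to the Σ-indexed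
degree-`K` flat family (`|ι| = C(t,K)8^K` exactly) and the deficiency subspace. -/
theorem bessel_of_stubs (hD : type_of% stub_deficiency) (hO : type_of% stub_flatOrthonormal)
    (hB : type_of% stub_massBound) :
    ∀ (t K r : ℕ) (a : Fin r → ℂ) (g : Fin r → QReg (t * 4) → ℂ), (∀ i, IsGaussian (g i)) →
      ((t.choose K * 8 ^ K : ℕ) : ℝ) - ((r * flatteningDeficiency K (t * 4) : ℕ) : ℝ)
        ≤ ((t.choose K * 8 ^ K : ℕ) : ℝ) * normSq (magicMPow t - ∑ i, a i • g i) := by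
  classical
  intro t K r a g hg
  -- the flat family: labels, monomials, index type
  let lab : (Fin t → Option (Fin 4 × Bool)) → List (Fin (t * 4) × Bool) := fun s =>
    (List.finRange t).filterMap fun b => (s b).map fun q => (finProdFinEquiv (b, q.1), q.2)
  let mono : (Fin t → Option (Fin 4 × Bool)) → Matrix (QReg (t * 4)) (QReg (t * 4)) ℂ := fun s =>
    ((List.finRange t).filterMap fun b =>
      (s b).map fun q => majorana (t * 4) (finProdFinEquiv (b, q.1)) q.2).prod
  have hmono_lab : ∀ s, mono s = ((lab s).map fun p => majorana (t * 4) p.1 p.2).prod := by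
    intro s
    simp only [mono, lab, List.map_filterMap, Option.map_map]
    rfl
  let ι : Type := Σ B : {B : Finset (Fin t) // B.card = K}, (B.1 → Fin 4 × Bool)
  -- deficiency: one subspace W of dimension ≤ r·D_K(4t) holds every degree-K monomial image of φ
  obtain ⟨W, hW, hmem⟩ := hD (t * 4) K r a g hg
  -- unitarity of the monomials
  have hunit : ∀ s, mono s ∈ Matrix.unitaryGroup (QReg (t * 4)) ℂ := by
    intro s
    rw [hmono_lab]
    refine list_prod_mem ?_
    intro x hx
    obtain ⟨p, -, rfl⟩ := List.mem_map.1 hx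
    exact majorana_mem_unitaryGroup _ _ _
  -- fullness: orthonormality of the images of M^{⊗t}
  obtain ⟨hO1, hO2⟩ := hO t mono (fun s => rfl)
  -- the mass bound over the Σ-indexed degree-K family
  have hmass := hB (t * 4) ι (fun x => mono (robustPattern x)) (magicMPow t) (∑ i, a i • g i) W
    (fun x => hunit _) (fun x => hO1 _)
    (fun x y hxy => hO2 _ _ fun h => hxy (robustPattern_injective t K h))
    (fun x => by
      show mono (robustPattern x) *ᵥ _ ∈ W
      rw [hmono_lab]
      exact hmem (lab (robustPattern x))
        ((length_filterMap_labels t (robustPattern x)).trans (robustPattern_support x)))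
  -- counting: |ι| = C(t,K)·8^K exactly
  have hcardι : Fintype.card ι = t.choose K * 8 ^ K :=
    Summit.QuantumAdvantage.QuantumAdvantage.Theorems.SpinorFlattening.countGap_card_sigma t K
  have hWR : (Module.finrank ℂ W : ℝ) ≤ ((r * flatteningDeficiency K (t * 4) : ℕ) : ℝ) := by
    exact_mod_cast hW
  rw [hcardι] at hmass
  push_cast at hmass hWR ⊢
  linarith

/-- **The crux over the named API** from the three stub statements: the strict count gives
`1 ≤ C(t,K)8^K − r·D_K(4t)`, C⁺ gives `… ≤ C(t,K)8^K · normSq`, and `C(t,K)8^K ≤ C(8t,K)`. -/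
theorem FlatteningBoundRobust_of_parts (hD : type_of% stub_deficiency) (hO : type_of% stub_flatOrthonormal)
    (hB : type_of% stub_massBound) :
    ∀ t K r : ℕ, r * flatteningDeficiency K (t * 4) < t.choose K * 8 ^ K →
      ∀ (a : Fin r → ℂ) (g : Fin r → QReg (t * 4) → ℂ), (∀ i, IsGaussian (g i)) →
        (1 : ℝ) ≤ ((t * 8).choose K : ℝ) * normSq (magicMPow t - ∑ i, a i • g i) := by
  intro t K r hcount a g hg
  have hb := bessel_of_stubs hD hO hB t K r a g hg
  have hfin : r * flatteningDeficiency K (t * 4) + 1 ≤ t.choose K * 8 ^ K := Nat.succ_le_of_lt hcount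
  have h1 : (1 : ℝ) ≤ ((t.choose K * 8 ^ K : ℕ) : ℝ) - ((r * flatteningDeficiency K (t * 4) : ℕ) : ℝ) := by
    have := (Nat.cast_le (α := ℝ)).2 hfin
    push_cast at this ⊢
    linarith
  have hnn : 0 ≤ normSq (magicMPow t - ∑ i, a i • g i) :=
    Finset.sum_nonneg fun _ _ => by positivity
  have hle : ((t.choose K * 8 ^ K : ℕ) : ℝ) ≤ ((t * 8).choose K : ℝ) := by
    exact_mod_cast choose_mul_eight_pow_le t K
  calc (1 : ℝ) ≤ ((t.choose K * 8 ^ K : ℕ) : ℝ) - ((r * flatteningDeficiency K (t * 4) : ℕ) : ℝ) := h1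
    _ ≤ ((t.choose K * 8 ^ K : ℕ) : ℝ) * normSq (magicMPow t - ∑ i, a i • g i) := hb
    _ ≤ ((t * 8).choose K : ℝ) * normSq (magicMPow t - ∑ i, a i • g i) :=
        mul_le_mul_of_nonneg_right hle hnn

/-- **The skeleton concludes the crux BY NAME**: `stub_deficiency → stub_flatOrthonormal → stub_massBound →
SpinorFlattening.FlatteningBoundRobust` (stmt-QuantumAdvantage-1246).  The route's inline `maj`/`IsGauss`/`Mpow`/count
are definitionally the tree's `majorana`/`IsGaussian`/`magicMPow`/`flatteningDeficiency`, so `show` converts. -/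
theorem FlatteningBoundRobust_of :
    type_of% stub_deficiency → type_of% stub_flatOrthonormal → type_of% stub_massBound →
      Summit.QuantumAdvantage.QuantumAdvantage.Theses.SpinorFlattening.FlatteningBoundRobust := by
  intro hD hO hB
  show ∀ t K r : ℕ, r * flatteningDeficiency K (t * 4) < t.choose K * 8 ^ K →
    ∀ (a : Fin r → ℂ) (g : Fin r → QReg (t * 4) → ℂ), (∀ i, IsGaussian (g i)) →
      (1 : ℝ) ≤ ((t * 8).choose K : ℝ) * normSq (magicMPow t - ∑ i, a i • g i)
  exact FlatteningBoundRobust_of_parts hD hO hB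

/-! ## Closure witness (sorry-free): every stub is already a theorem of the tree -/

/-- `stub_deficiency` DISCHARGED from the landed parts `stub_normalOrder` (p75761) and `stub_filterCard` (p74182) —
verbatim the landed composition `Theorems.SpinorFlattening.deficiency_of_parts`/`deficiency` (p76218), repeated here only
because that composed module was not yet built on the farm when this skeleton was checked. -/
theorem deficiency_closed : type_of% stub_deficiency := by
  intro n K r a g hg
  classical
  choose u hu using fun i =>
    Summit.QuantumAdvantage.QuantumAdvantage.Theorems.SpinorFlattening.stub_normalOrder n K (g i) (hg i)
  let ι : Type := {I : Finset (Fin n) // I.card ≤ K ∧ I.card % 2 = K % 2}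
  let f : Fin r → ι → (QReg n → ℂ) := fun i I =>
    ((I.1.sort (· ≤ ·)).map fun j => ∑ p : Fin n × Bool, u i j p • majorana n p.1 p.2).prod *ᵥ g i
  let F : Fin r × ι → (QReg n → ℂ) := fun x => f x.1 x.2
  refine ⟨Submodule.span ℂ (Set.range F), ?_, ?_⟩
  · calc Module.finrank ℂ (Submodule.span ℂ (Set.range F)) ≤ Fintype.card (Fin r × ι) :=
          finrank_range_le_card F
      _ = r * flatteningDeficiency K n := by
          rw [Fintype.card_prod, Fintype.card_fin,
            Summit.QuantumAdvantage.QuantumAdvantage.Theorems.SpinorFlattening.stub_filterCard]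
  · intro l hl
    rw [Matrix.mulVec_sum]
    refine Submodule.sum_mem _ fun i _ => ?_
    rw [Matrix.mulVec_smul]
    refine Submodule.smul_mem _ _ ?_
    have hsub : Submodule.span ℂ (Set.range (f i)) ≤ Submodule.span ℂ (Set.range F) :=
      Submodule.span_mono (by
        rintro _ ⟨I, rfl⟩
        exact ⟨(i, I), rfl⟩)
    exact hsub (hu i l hl)

/-- `stub_flatOrthonormal` DISCHARGED from the landed parts `stub_flatOrthoOfInvariant` (p74600) and
`stub_magicInvariant` (p74598) — verbatim the landed `Theorems.SpinorFlattening.flatOrthonormal` (p76218). -/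
theorem flatOrthonormal_closed : type_of% stub_flatOrthonormal := by
  intro t mono hmono
  obtain ⟨hX, hZ, h1⟩ := Summit.QuantumAdvantage.QuantumAdvantage.Theorems.SpinorFlattening.stub_magicInvariant t
  exact Summit.QuantumAdvantage.QuantumAdvantage.Theorems.SpinorFlattening.stub_flatOrthoOfInvariant t mono hmono
    (magicMPow t) hX hZ h1

/-- `stub_massBound` DISCHARGED: it is the landed `Theorems.SpinorFlattening.stub_massBound` (p71968). -/
theorem massBound_closed : type_of% stub_massBound :=
  Summit.QuantumAdvantage.QuantumAdvantage.Theorems.SpinorFlattening.stub_massBound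

/-- THE LINE IS CLOSED: the crux, sorry-free, from the landed theorems whose statements the stubs copy verbatim.
This typechecks only because each stub signature is exactly the landed one; it is the lead's ready-made landing
(`exact deficiency_closed` / `flatOrthonormal_closed` / `massBound_closed` — or, once module `Theorems.SpinorFlatteningNegApproxGaussRankSuperpoly` (p76218) is built on the
farm, `exact Theorems.SpinorFlattening.deficiency` / `.flatOrthonormal` / `.stub_massBound` — then propose `--workitem`). -/
theorem flatteningBoundRobust_closed :
    Summit.QuantumAdvantage.QuantumAdvantage.Theses.SpinorFlattening.FlatteningBoundRobust :=
  FlatteningBoundRobust_of deficiency_closed flatOrthonormal_closed massBound_closed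

/-- By-product for support item stmt-QuantumAdvantage-1249 (`FlatteningBoundExact`, the `δ = 0` core): under the
same count `M^{⊗t}` is not an `r`-term Gaussian combination (else `1 ≤ C(8t,K) · normSq 0 = 0`). -/
theorem flatteningBoundExact_of_robust :
    Summit.QuantumAdvantage.QuantumAdvantage.Theses.SpinorFlattening.FlatteningBoundRobust →
      Summit.QuantumAdvantage.QuantumAdvantage.Theses.SpinorFlattening.FlatteningBoundExact := by
  intro h
  have h' : ∀ t K r : ℕ, r * flatteningDeficiency K (t * 4) < t.choose K * 8 ^ K →
      ∀ (a : Fin r → ℂ) (g : Fin r → QReg (t * 4) → ℂ), (∀ i, IsGaussian (g i)) →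
        (1 : ℝ) ≤ ((t * 8).choose K : ℝ) * normSq (magicMPow t - ∑ i, a i • g i) := h
  show ∀ t K r : ℕ, r * flatteningDeficiency K (t * 4) < t.choose K * 8 ^ K →
    ∀ (a : Fin r → ℂ) (g : Fin r → QReg (t * 4) → ℂ), (∀ i, IsGaussian (g i)) →
      magicMPow t ≠ ∑ i, a i • g i
  intro t K r hcount a g hg heq
  have key := h' t K r hcount a g hg
  have h0 : normSq (magicMPow t - ∑ i, a i • g i) = 0 := by
    rw [← heq, sub_self]
    simp [normSq]
  rw [h0, mul_zero] at key
  exact absurd key (by norm_num)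

end Summit.QuantumAdvantage.QuantumAdvantage.Cruxes.FlatteningBoundRobust.IsometricSubflatteningBessel

end
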